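import Summits.Ventures.CertifiedManyBodySolver.Observables.StiffnessHalfBathtubBox
import HarnessLib

/-!
# Ventures/CertifiedManyBodySolver — Observables/StiffnessHalfBathtubChord.lean

HONEST FRAMING: node-free one-body (kinematic, half-bathtub) CEILINGS on the uniform flux stiffness, interpolated along a `t′`-CHORD between
two certified corner rows with DIFFERENT constants; a ceiling never speaks to the presence of order; not a `T_c`, not a superconductivity verdict;
no phase sentence. Zero compute, no definition, no claim node, no `sorry`.

Cell `pub/hubbard-downfold` (D-0150 L-DF2), seat `hubbard-downfold-unc-2` (`prover-hubbard-downfold-unc-2-g16-0`); a variant of hubbard-tc p1's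
`halfBathtub_box_le` (`Observables/StiffnessHalfBathtubBox.lean`): there both corners are bounded by ONE constant `c` and the box inherits `c`;
here the corners carry their own constants `c₁, c₂` and, by the JOINT convexity of `(t′, ν) ↦ ν·n/2 + B(t′, ν)` (`halfBathtubIntegral_convex`),
every interior `t′` inherits the CHORD `((t₂ − t′)c₁ + (t′ − t₁)c₂)/(t₂ − t₁)` — so two existing pair-table rows give a `t′`-RESOLVED kinematic leaf
on the whole segment, not only the larger corner value.

* §1 `halfBathtub_chord_le`;  §2 the ground-state and thermal leaves on the chord, and the monotone sub-interval form (`c₂ ≤ c₁`: on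
  `[s, t₂]` the chord value at `s` suffices — one decidable inequality).

References: T. Hazra, N. Verma, M. Randeria, PRX 9 (2019) 031049, eqs. (2)–(6) [HazraVermaRanderia2019]; A. Paramekanti, N. Trivedi,
M. Randeria, PRB 57 (1998) 11639, eq. (3), §IV [ParamekantiTrivediRanderia1998].
-/

noncomputable section

namespace Summit.Ventures.CertifiedManyBodySolver.Observables

open Real MeasureTheory Set Filter Topology

/-! ## §1 The chord transport of the half-bathtub constant -/

/-- **Chord transport of the half-bathtub constant.** `ν₁, ν₂ ≥ 0`, `t₁ < t₂`; corner values at the top filling `n₂`: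
`νᵢ·n₂/2 + B(tᵢ, νᵢ) ≤ cᵢ` (`i = 1, 2`). Then for every `t′ ∈ [t₁, t₂]` and `n ≤ n₂` there is a level `ν ≥ 0` with
`ν·n/2 + B(t′, ν) ≤ ((t₂ − t′)·c₁ + (t′ − t₁)·c₂)/(t₂ − t₁)` (take `ν = aν₁ + bν₂`, `a = (t₂ − t′)/(t₂ − t₁)`, `b = (t′ − t₁)/(t₂ − t₁)`; joint convexity).
[cite: HazraVermaRanderia2019, eqs. (2)–(6)] -/
theorem halfBathtub_chord_le {t₁ t₂ ν₁ ν₂ n₂ c₁ c₂ : ℝ} (hν₁ : 0 ≤ ν₁) (hν₂ : 0 ≤ ν₂) (ht : t₁ < t₂)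
    (h₁ : ν₁ * n₂ / 2 +
      (∫ y in (-π)..π, ∫ x in (-π)..π, max (Real.cos x + Real.cos y + 4 * t₁ * (Real.cos x * Real.cos y) - ν₁) 0) /
        (4 * π ^ 2) ≤ c₁)
    (h₂ : ν₂ * n₂ / 2 +
      (∫ y in (-π)..π, ∫ x in (-π)..π, max (Real.cos x + Real.cos y + 4 * t₂ * (Real.cos x * Real.cos y) - ν₂) 0) /
        (4 * π ^ 2) ≤ c₂)
    {tp n : ℝ} (htp : tp ∈ Icc t₁ t₂) (hn : n ≤ n₂) :
    ∃ ν : ℝ, 0 ≤ ν ∧ ν * n / 2 +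
      (∫ y in (-π)..π, ∫ x in (-π)..π, max (Real.cos x + Real.cos y + 4 * tp * (Real.cos x * Real.cos y) - ν) 0) /
        (4 * π ^ 2) ≤ (t₂ - tp) / (t₂ - t₁) * c₁ + (tp - t₁) / (t₂ - t₁) * c₂ := by
  have hπ2 : (0 : ℝ) < 4 * π ^ 2 := by positivity
  have hd : 0 < t₂ - t₁ := sub_pos.2 ht
  set a := (t₂ - tp) / (t₂ - t₁) with hadef
  set b := (tp - t₁) / (t₂ - t₁) with hbdef
  have ha : 0 ≤ a := div_nonneg (sub_nonneg.2 htp.2) hd.le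
  have hb : 0 ≤ b := div_nonneg (sub_nonneg.2 htp.1) hd.le
  have hab : a + b = 1 := by
    rw [hadef, hbdef, ← add_div, div_eq_one_iff_eq hd.ne']
    ring
  have htpab : tp = a * t₁ + b * t₂ := by
    rw [hadef, hbdef]
    field_simp
    ring
  refine ⟨a * ν₁ + b * ν₂, add_nonneg (mul_nonneg ha hν₁) (mul_nonneg hb hν₂), ?_⟩
  have hconv := halfBathtubIntegral_convex t₁ t₂ ν₁ ν₂ a b ha hb hab
  rw [← htpab] at hconv
  have hmono : (a * ν₁ + b * ν₂) * n / 2 ≤ (a * ν₁ + b * ν₂) * n₂ / 2 := by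
    have hν : 0 ≤ a * ν₁ + b * ν₂ := add_nonneg (mul_nonneg ha hν₁) (mul_nonneg hb hν₂)
    nlinarith
  have hdiv' := div_le_div_of_nonneg_right hconv hπ2.le
  have e : (a * (∫ y in (-π)..π, ∫ x in (-π)..π,
        max (Real.cos x + Real.cos y + 4 * t₁ * (Real.cos x * Real.cos y) - ν₁) 0) +
      b * (∫ y in (-π)..π, ∫ x in (-π)..π,
        max (Real.cos x + Real.cos y + 4 * t₂ * (Real.cos x * Real.cos y) - ν₂) 0)) / (4 * π ^ 2) =
      a * ((∫ y in (-π)..π, ∫ x in (-π)..π,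
        max (Real.cos x + Real.cos y + 4 * t₁ * (Real.cos x * Real.cos y) - ν₁) 0) / (4 * π ^ 2)) +
      b * ((∫ y in (-π)..π, ∫ x in (-π)..π,
        max (Real.cos x + Real.cos y + 4 * t₂ * (Real.cos x * Real.cos y) - ν₂) 0) / (4 * π ^ 2)) := by
    ring
  have hdiv : (∫ y in (-π)..π, ∫ x in (-π)..π,
      max (Real.cos x + Real.cos y + 4 * tp * (Real.cos x * Real.cos y) - (a * ν₁ + b * ν₂)) 0) / (4 * π ^ 2) ≤
      a * ((∫ y in (-π)..π, ∫ x in (-π)..π,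
        max (Real.cos x + Real.cos y + 4 * t₁ * (Real.cos x * Real.cos y) - ν₁) 0) / (4 * π ^ 2)) +
      b * ((∫ y in (-π)..π, ∫ x in (-π)..π,
        max (Real.cos x + Real.cos y + 4 * t₂ * (Real.cos x * Real.cos y) - ν₂) 0) / (4 * π ^ 2)) := by
    rw [← e]
    exact hdiv'
  have hcomb : a * (ν₁ * n₂ / 2 + (∫ y in (-π)..π, ∫ x in (-π)..π,
        max (Real.cos x + Real.cos y + 4 * t₁ * (Real.cos x * Real.cos y) - ν₁) 0) / (4 * π ^ 2)) +
      b * (ν₂ * n₂ / 2 + (∫ y in (-π)..π, ∫ x in (-π)..π,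
        max (Real.cos x + Real.cos y + 4 * t₂ * (Real.cos x * Real.cos y) - ν₂) 0) / (4 * π ^ 2)) ≤ a * c₁ + b * c₂ :=
    add_le_add (mul_le_mul_of_nonneg_left h₁ ha) (mul_le_mul_of_nonneg_left h₂ hb)
  linarith [hmono, hdiv, hcomb]

/-! ## §2 The leaves on the chord -/

/-- **Corner rows ⇒ the GROUND-STATE stiffness leaf along the chord**: with `ν₁, ν₂ ≥ 0`, `t₁ < t₂`, `n₂ ≤ 2`, corner values `c₁, c₂` and a rational `c`
with `((t₂ − t′)c₁ + (t′ − t₁)c₂)/(t₂ − t₁) ≤ c`: `ObsStiffnessSeqCeilingAt tp U n c` for `0 ≤ n ≤ n₂`, every `U`. [cite: HazraVermaRanderia2019, eqs. (2)–(6)] -/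
theorem ObsStiffnessSeqCeilingAt_chord_of_corners_le {t₁ t₂ ν₁ ν₂ n₂ c₁ c₂ : ℝ} (hν₁ : 0 ≤ ν₁) (hν₂ : 0 ≤ ν₂) (ht : t₁ < t₂)
    (hn₂ : n₂ ≤ 2)
    (h₁ : ν₁ * n₂ / 2 +
      (∫ y in (-π)..π, ∫ x in (-π)..π, max (Real.cos x + Real.cos y + 4 * t₁ * (Real.cos x * Real.cos y) - ν₁) 0) /
        (4 * π ^ 2) ≤ c₁)
    (h₂ : ν₂ * n₂ / 2 +
      (∫ y in (-π)..π, ∫ x in (-π)..π, max (Real.cos x + Real.cos y + 4 * t₂ * (Real.cos x * Real.cos y) - ν₂) 0) /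
        (4 * π ^ 2) ≤ c₂)
    {tp U n : ℝ} (htp : tp ∈ Icc t₁ t₂) (hn0 : 0 ≤ n) (hn : n ≤ n₂) (c : ℚ)
    (hc : (t₂ - tp) / (t₂ - t₁) * c₁ + (tp - t₁) / (t₂ - t₁) * c₂ ≤ ((c : ℚ) : ℝ)) :
    ObsStiffnessSeqCeilingAt tp U n c := by
  obtain ⟨ν, _, hν⟩ := halfBathtub_chord_le hν₁ hν₂ ht h₁ h₂ htp hn
  exact ObsStiffnessSeqCeilingAt_of_halfBathtub_le tp U n hn0 (hn.trans hn₂) ν c (hν.trans hc)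

/-- **The THERMAL twin** (every temperature): the same chord gives `ObsThermalStiffnessSeqCeilingAt tp U n c`. [cite: ParamekantiTrivediRanderia1998, eq. (3) and §IV] -/
theorem ObsThermalStiffnessSeqCeilingAt_chord_of_corners_le {t₁ t₂ ν₁ ν₂ n₂ c₁ c₂ : ℝ} (hν₁ : 0 ≤ ν₁) (hν₂ : 0 ≤ ν₂) (ht : t₁ < t₂)
    (hn₂ : n₂ ≤ 2)
    (h₁ : ν₁ * n₂ / 2 +
      (∫ y in (-π)..π, ∫ x in (-π)..π, max (Real.cos x + Real.cos y + 4 * t₁ * (Real.cos x * Real.cos y) - ν₁) 0) /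
        (4 * π ^ 2) ≤ c₁)
    (h₂ : ν₂ * n₂ / 2 +
      (∫ y in (-π)..π, ∫ x in (-π)..π, max (Real.cos x + Real.cos y + 4 * t₂ * (Real.cos x * Real.cos y) - ν₂) 0) /
        (4 * π ^ 2) ≤ c₂)
    {tp U n : ℝ} (htp : tp ∈ Icc t₁ t₂) (hn0 : 0 ≤ n) (hn : n ≤ n₂) (c : ℚ)
    (hc : (t₂ - tp) / (t₂ - t₁) * c₁ + (tp - t₁) / (t₂ - t₁) * c₂ ≤ ((c : ℚ) : ℝ)) :
    ObsThermalStiffnessSeqCeilingAt tp U n c := by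
  obtain ⟨ν, _, hν⟩ := halfBathtub_chord_le hν₁ hν₂ ht h₁ h₂ htp hn
  exact ObsThermalStiffnessSeqCeilingAt_of_halfBathtub_le tp U n hn0 (hn.trans hn₂) ν c (hν.trans hc)

/-- **Monotone sub-interval form.** If moreover `c₂ ≤ c₁` (the corner value at `t₁` is the larger), the chord is non-increasing in `t′`, so on
`[s, t₂]` (`t₁ ≤ s`) the single number `((t₂ − s)c₁ + (s − t₁)c₂)/(t₂ − t₁) ≤ c` gives the leaf at every `tp ∈ [s, t₂]` — one decidable inequality.
[cite: HazraVermaRanderia2019, eqs. (2)–(6)] -/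
theorem ObsStiffnessSeqCeilingAt_subinterval_of_corners_le {t₁ t₂ ν₁ ν₂ n₂ c₁ c₂ : ℝ} (hν₁ : 0 ≤ ν₁) (hν₂ : 0 ≤ ν₂) (ht : t₁ < t₂)
    (hn₂ : n₂ ≤ 2) (hc₁₂ : c₂ ≤ c₁)
    (h₁ : ν₁ * n₂ / 2 +
      (∫ y in (-π)..π, ∫ x in (-π)..π, max (Real.cos x + Real.cos y + 4 * t₁ * (Real.cos x * Real.cos y) - ν₁) 0) /
        (4 * π ^ 2) ≤ c₁)
    (h₂ : ν₂ * n₂ / 2 +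
      (∫ y in (-π)..π, ∫ x in (-π)..π, max (Real.cos x + Real.cos y + 4 * t₂ * (Real.cos x * Real.cos y) - ν₂) 0) /
        (4 * π ^ 2) ≤ c₂)
    {s : ℝ} (hs : t₁ ≤ s) (c : ℚ) (hc : (t₂ - s) / (t₂ - t₁) * c₁ + (s - t₁) / (t₂ - t₁) * c₂ ≤ ((c : ℚ) : ℝ))
    {tp U n : ℝ} (htp : tp ∈ Icc s t₂) (hn0 : 0 ≤ n) (hn : n ≤ n₂) :
    ObsStiffnessSeqCeilingAt tp U n c := by
  have hd : 0 < t₂ - t₁ := sub_pos.2 ht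
  refine ObsStiffnessSeqCeilingAt_chord_of_corners_le hν₁ hν₂ ht hn₂ h₁ h₂ ⟨hs.trans htp.1, htp.2⟩ hn0 hn c (le_trans ?_ hc)
  -- the chord is non-increasing in `tp` when `c₂ ≤ c₁`
  rw [div_mul_eq_mul_div, div_mul_eq_mul_div, div_mul_eq_mul_div, div_mul_eq_mul_div, ← add_div, ← add_div,
    div_le_div_iff_of_pos_right hd]
  nlinarith [htp.1, hc₁₂]

/-- Thermal twin of the sub-interval form. [cite: ParamekantiTrivediRanderia1998, eq. (3) and §IV] -/
theorem ObsThermalStiffnessSeqCeilingAt_subinterval_of_corners_le {t₁ t₂ ν₁ ν₂ n₂ c₁ c₂ : ℝ} (hν₁ : 0 ≤ ν₁) (hν₂ : 0 ≤ ν₂)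
    (ht : t₁ < t₂) (hn₂ : n₂ ≤ 2) (hc₁₂ : c₂ ≤ c₁)
    (h₁ : ν₁ * n₂ / 2 +
      (∫ y in (-π)..π, ∫ x in (-π)..π, max (Real.cos x + Real.cos y + 4 * t₁ * (Real.cos x * Real.cos y) - ν₁) 0) /
        (4 * π ^ 2) ≤ c₁)
    (h₂ : ν₂ * n₂ / 2 +
      (∫ y in (-π)..π, ∫ x in (-π)..π, max (Real.cos x + Real.cos y + 4 * t₂ * (Real.cos x * Real.cos y) - ν₂) 0) /
        (4 * π ^ 2) ≤ c₂)
    {s : ℝ} (hs : t₁ ≤ s) (c : ℚ) (hc : (t₂ - s) / (t₂ - t₁) * c₁ + (s - t₁) / (t₂ - t₁) * c₂ ≤ ((c : ℚ) : ℝ))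
    {tp U n : ℝ} (htp : tp ∈ Icc s t₂) (hn0 : 0 ≤ n) (hn : n ≤ n₂) :
    ObsThermalStiffnessSeqCeilingAt tp U n c := by
  have hd : 0 < t₂ - t₁ := sub_pos.2 ht
  refine ObsThermalStiffnessSeqCeilingAt_chord_of_corners_le hν₁ hν₂ ht hn₂ h₁ h₂ ⟨hs.trans htp.1, htp.2⟩ hn0 hn c (le_trans ?_ hc)
  rw [div_mul_eq_mul_div, div_mul_eq_mul_div, div_mul_eq_mul_div, div_mul_eq_mul_div, ← add_div, ← add_div,
    div_le_div_iff_of_pos_right hd]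
  nlinarith [htp.1, hc₁₂]

end Summit.Ventures.CertifiedManyBodySolver.Observables

end
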